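import Summits.BirchSwinnertonDyer.BirchSwinnertonDyer.Theorems.KolyvaginRoadThreeZhangSupplyTransverseLagrangian
import Summits.BirchSwinnertonDyer.BirchSwinnertonDyer.Theorems.KolyvaginRoadThreeZhangSupplyOrdinaryWitness
import Summits.BirchSwinnertonDyer.BirchSwinnertonDyer.Theorems.KolyvaginRoadThreeZhangSupplyJumpStructures
import Summits.BirchSwinnertonDyer.BirchSwinnertonDyer.Theorems.KolyvaginRoadThreeZhangSupplyLocalH1CardKolyvagin
import HarnessLib

/-!
# Route `KolyvaginRoadThree`, deciding crux `ZhangSharpFrameAtThreeHL` (item stmt-BirchSwinnertonDyer-19574):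
# (Lag-tr) part 2 — NINE genuine transverse classes at a Kolyvagin prime (`#Ltr · #Ltr = 81`), and the (J) binder
# `hjump` of S2-ENGINE's (Supply) FROM THE POITOU–TATE FACT ALONE
# (cell `bsd-stepL`, ACCEL seat `bsd-stepL-koly3b` g6; `--supports stmt-BirchSwinnertonDyer-19574`, helper; part XXII of the
# `KolyvaginRoadThreeZhangSupply*` series)

HONEST FRAMING. Theorems only; 0 definitions, 0 named facts, 0 `sorry`; the last theorem is CONDITIONAL on the named
Poitou–Tate fact `poitouTate_selmerStructure_duality K` only; closes nothing (T7). PARTITION: O2@3 (B10) × A1 × crux 19574 ×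
the S2-ENGINE's (Supply) binder — proves-glue.

WHAT.
* §4 `htrCard_transverseLocalCondition` — at a Kolyvagin prime `λ` (frame with `d_K < −4`),
  `#transverseLocalCondition · #transverseLocalCondition = #H¹(K_λ, E[3])` (`= 81`, part XVII): UPPER from the isotropy
  (part XXI) and `natCard_mul_natCard_le_of_isotropic` (part XIX); LOWER from the NINE classes `s ↦ k(s) • Q`, `Q ∈ E[3]`,
  `χ s = χ σ₁ ^ k(s)` for the generator `χ σ₁` of order `ℓ + 1 ≡ 0 (mod 3)` of part XXI's package — continuous (`χ`
  locally constant), additive mod `3`, vanishing on `ker χ = res⁻¹(Stab K[ℓ])`, pairwise non-cohomologous (value `Q` at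
  `σ₁`), `#E[3] = 9`.
* §5 `hjump_of_poitouTate` — the binder `hjump` of `supply_signed_of_jump_bound` (part XIII) VERBATIM, from
  `IsImaginaryQuadratic K`, `d_K < −4`, the places `plK` and the PT fact: part XVIII `hjump_of_localLagrangians` with
  `Lord v := Method2.ordinaryLocalCondition` (clauses: parts XIX–XX) and `Ltr (plK ℓ′) := Method2.transverseLocalCondition …
  ℓ′` (clauses: part XXI and §4). With part XIII: `hSupply` ⟸ {capstone apparatus, PT fact, (IsoBound) `hbound`}.

References: [cite: WZhang2014, §8.1 (dim H¹_tr = 2), Lemma 8.2] [cite: McCallumLMS1991, Prop. 2.1] [cite: GrossLMS1991,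
§3–§4] [cite: MilneADT2006, Ch. I, Thm. 2.8, Thm. 4.10].
-/

noncomputable section

open scoped Classical Pointwise

universe u

namespace Summit.BirchSwinnertonDyer.Rank1Residual.X11b.Three.Koly.ZhangSupply

open CategoryTheory WeierstrassCurve Field Function NumberField IsDedekindDomain
open Literature.NumberTheory.EllipticCurves Literature.NumberTheory.EllipticCurves.ModularForms
  Literature.NumberTheory.GaloisRepresentations Module
open Literature.NumberTheory.GaloisRepresentations.DiscreteGaloisModule (mu MuCarrier)
open Literature.NumberTheory.GaloisCohomology
open Summit.BirchSwinnertonDyer.Rank1Residual.X11b.Three.Koly.Method2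
open Summit.BirchSwinnertonDyer.Rank1Residual.X11b.Three.Koly.Method2.KolyLocal
open Summit.BirchSwinnertonDyer.Rank1Residual.GaloisImage
open scoped ContRepresentation

-- Cup products need `LocallyCompactSpace Γ`; `E[n]` finite: local instances (as in the tree's cup-product files).
attribute [local instance] absoluteGaloisGroup_compactSpace
attribute [local instance] finite_geomTorsion_of_neZero

variable (W : WeierstrassCurve ℚ) (K : Type) [Field K] [NumberField K] [W.IsElliptic] [W.IsGloballyMinimal]

/-! ## §4 The count clause `htrCard`: nine transverse classes -/

omit [W.IsElliptic] [W.IsGloballyMinimal] in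
/-- `a • Q = b • Q` for `a ≡ b (mod 3)` and a `3`-torsion point. [folklore] -/
theorem nsmul_eq_nsmul_of_modEq_three {P : geomTorsion (W.baseChange K) ((3 ^ 1 : ℕ) : ℤ)} {a b : ℕ}
    (h : a ≡ b [MOD 3]) : a • P = b • P := by
  have hn : 3 • P = 0 := by
    have := AddSubgroup.torsionBy.nsmul P
    exact_mod_cast this
  have key : ∀ c : ℕ, c • P = (c % 3) • P := fun c ↦ by
    conv_lhs => rw [← Nat.mod_add_div c 3, add_nsmul, mul_nsmul, hn, nsmul_zero, add_zero]
  rw [key a, key b, h]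

/-- **(Lag-tr), count clause `htrCard`** of `hjump_of_localLagrangians` for `Ltr λ := transverseLocalCondition`: at a
Kolyvagin prime `λ` (with `d_K < −4`), `#Ltr · #Ltr = #H¹(K_λ, E[3])` (`= 81`, part XVII). UPPER: isotropy (§3) and part
XIX's `natCard_mul_natCard_le_of_isotropic` give `#Ltr ≤ 9`. LOWER: the NINE classes `s ↦ k(s) • Q` (`Q ∈ E[3]`), where
`χ s = χ σ₁ ^ k(s)` for the generator `χ σ₁` of order `ℓ + 1 ≡ 0 (mod 3)` of `χ(Γ_{K_λ}) = Gal(K[ℓ]/K[1])`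
(`exists_kolyvagin_character`: total ramification); they vanish on `ker χ = res⁻¹(Stab K[ℓ])`, are pairwise
non-cohomologous (value `Q` at `σ₁`; coboundaries vanish), and `#E[3] = 9`. [cite: WZhang2014, §8.1 (dim H¹_tr = 2)]
[cite: GrossLMS1991, §3–§4] [cite: MilneADT2006, Ch. I, Thm. 2.8] -/
theorem htrCard_transverseLocalCondition (hK : IsImaginaryQuadratic K) (hd : NumberField.discr K < -4) (ι : K →+* ℂ)
    {ℓ : ℕ} (hℓ : Zhang2014.IsKolyvaginPrime (W.conductorNorm ℤ) W K 3 ℓ) (v : HeightOneSpectrum (𝓞 K))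
    (hv : (ℓ : 𝓞 K) ∈ v.asIdeal) :
    Nat.card (transverseLocalCondition (W.baseChange K) ι ℓ (v.adicCompletion K) ((3 ^ 1 : ℕ) : ℤ)) *
        Nat.card (transverseLocalCondition (W.baseChange K) ι ℓ (v.adicCompletion K) ((3 ^ 1 : ℕ) : ℤ)) =
      Nat.card (galoisCohomology (((W.baseChange K).torsionGaloisModule ((3 ^ 1 : ℕ) : ℤ)).toLocal (Sum.inr v)) 1) := by
  haveI : NeZero (3 ^ 1 : ℕ) := ⟨by norm_num⟩
  haveI : Finite (geomTorsion (W.baseChange K) ((3 ^ 1 : ℕ) : ℤ)) := finite_geomTorsion_of_neZero _ _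
  haveI hfinH : Finite (galoisCohomology (GaloisRep.restrictField (v.adicCompletion K)
      ((W.baseChange K).torsionGaloisModule ((3 ^ 1 : ℕ) : ℤ))) 1) :=
    KummerPT.finite_galoisCohomology_toLocal_inr (W.baseChange K) (3 ^ 1) v
  set Kv := v.adicCompletion K with hKv
  set Lv := transverseLocalCondition (W.baseChange K) ι ℓ Kv ((3 ^ 1 : ℕ) : ℤ) with hLv
  have h81 := natCard_galoisCohomology_one_toLocal_eq_of_kolyvagin W K hK hℓ v hv
  have h3ℓ : 3 ∣ ℓ + 1 := (Zhang2014.IsKolyvaginPrime.dvd (p := 3) hℓ).1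
  -- upper bound
  have hle : Nat.card Lv ≤ 9 := by
    have h := natCard_mul_natCard_le_of_isotropic W K hK v Lv
      (fun e hμ hadd₁ hadd₂ _ _ hgal ↦ htrIso_transverseLocalCondition W K hK hd ι hℓ v hv e hμ hadd₁ hadd₂ hgal)
    rw [h81] at h
    by_contra hgt
    push Not at hgt
    have h100 : 10 * 10 ≤ Nat.card Lv * Nat.card Lv := Nat.mul_le_mul hgt hgt
    exact absurd (le_trans h100 h) (by norm_num)
  -- lower bound: the nine classes `s ↦ k(s) • Q`
  obtain ⟨𝔐, h𝔐, χ, σ₁, hfix, -, hker, hlc, hgen, hord⟩ := exists_kolyvagin_character W K hK hd ι hℓ v hv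
  let kOf : ringClassGal ι ℓ → ℕ := fun g ↦ if h : ∃ i : ℕ, g = χ σ₁ ^ i then Classical.choose h else 0
  let k : absoluteGaloisGroup Kv → ℕ := fun s ↦ kOf (χ s)
  have hk : ∀ s, χ s = χ σ₁ ^ k s := fun s ↦ by
    have hex : ∃ i : ℕ, χ s = χ σ₁ ^ i := hgen s
    have h := Classical.choose_spec hex
    simp only [k, kOf, dif_pos hex]
    exact h
  have hkmul : ∀ s t, k (s * t) ≡ k s + k t [MOD 3] := fun s t ↦ by
    refine Nat.ModEq.of_dvd h3ℓ ?_
    rw [← hord, ← pow_eq_pow_iff_modEq, ← hk, map_mul, hk s, hk t, pow_add]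
  have hk1 : k σ₁ ≡ 1 [MOD 3] := by
    refine Nat.ModEq.of_dvd h3ℓ ?_
    rw [← hord, ← pow_eq_pow_iff_modEq, ← hk, pow_one]
  have hk0 : ∀ s, absGaloisRestrict K Kv s ∈ ringClassStabilizer K ι ℓ ℓ → k s ≡ 0 [MOD 3] := fun s hs ↦ by
    refine Nat.ModEq.of_dvd h3ℓ ?_
    rw [← hord, ← pow_eq_pow_iff_modEq, ← hk, pow_zero]
    exact (hker s).mpr hs
  have hlck : ∀ Q : geomTorsion (W.baseChange K) ((3 ^ 1 : ℕ) : ℤ), IsLocallyConstant fun s ↦ k s • Q := fun Q ↦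
    hlc.comp fun g ↦ kOf g • Q
  have hfix' : ∀ (τ : absoluteGaloisGroup Kv) (m : ℕ) (Q : geomTorsion (W.baseChange K) ((3 ^ 1 : ℕ) : ℤ)),
      absGaloisRestrict K Kv τ • (m • Q) = m • Q := fun τ m Q ↦ by rw [smul_comm, hfix]
  -- the cocycle `θ_Q`
  let θ : geomTorsion (W.baseChange K) ((3 ^ 1 : ℕ) : ℤ) →
      contOneCocycles (DiscreteGaloisModule.toTopRep (GaloisRep.restrictField Kv
        ((W.baseChange K).torsionGaloisModule ((3 ^ 1 : ℕ) : ℤ)))) := fun Q ↦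
    ⟨⟨fun s ↦ k s • Q, (hlck Q).continuous⟩, fun g h ↦ by
      change k (g * h) • Q = k g • Q + absGaloisRestrict K Kv g • (k h • Q)
      rw [hfix', ← add_nsmul]
      exact nsmul_eq_nsmul_of_modEq_three W K (hkmul g h)⟩
  have hθ : ∀ Q s, (θ Q).1 s = k s • Q := fun _ _ ↦ rfl
  have hθmem : ∀ Q, oneCocycleClass _ (θ Q) ∈ Lv := fun Q ↦
    ⟨θ Q, fun s hs ↦ by rw [hθ, nsmul_eq_nsmul_of_modEq_three W K (hk0 s hs), zero_nsmul], rfl⟩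
  -- injectivity of `Q ↦ [θ_Q]`
  let f : geomTorsion (W.baseChange K) ((3 ^ 1 : ℕ) : ℤ) → Lv := fun Q ↦ ⟨oneCocycleClass _ (θ Q), hθmem Q⟩
  have hf : Function.Injective f := by
    intro Q Q' hQQ'
    have h : oneCocycleClass _ (θ Q) - oneCocycleClass _ (θ Q') = 0 := by
      rw [sub_eq_zero]; exact congrArg Subtype.val hQQ'
    rw [← oneCocycleClass_sub] at h
    obtain ⟨m, hm⟩ := (oneCocycleClass_eq_zero_iff _ _).mp h
    have hs := hm σ₁
    change k σ₁ • Q - k σ₁ • Q' = absGaloisRestrict K Kv σ₁ • m - m at hs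
    rw [hfix, sub_self, sub_eq_zero, nsmul_eq_nsmul_of_modEq_three W K hk1, nsmul_eq_nsmul_of_modEq_three W K hk1,
      one_nsmul, one_nsmul] at hs
    exact hs
  have h9 : Nat.card (geomTorsion (W.baseChange K) ((3 ^ 1 : ℕ) : ℤ)) = 9 := by
    rw [natCard_geomTorsion (W.baseChange K) ((3 ^ 1 : ℕ) : ℤ) (by norm_num)]; norm_num
  haveI : Finite Lv := inferInstance
  have hge : 9 ≤ Nat.card Lv := h9 ▸ Nat.card_le_card_of_injective f hf
  have hcard : Nat.card Lv = 9 := le_antisymm hle hge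
  rw [hcard, h81]

/-! ## §5 The (J) binder `hjump` from the Poitou–Tate fact alone -/

omit [W.IsElliptic] in
/-- The places of the Kolyvagin primes are pairwise distinct (`hplK`). [folklore] -/
theorem plK_injective (plK : {ℓ // Zhang2014.IsKolyvaginPrime (W.conductorNorm ℤ) W K 3 ℓ} → HeightOneSpectrum (𝓞 K))
    (hplK : ∀ ℓ, ((ℓ : ℕ) : 𝓞 K) ∈ (plK ℓ).asIdeal) : Function.Injective plK := by
  intro ℓ ℓ' h
  by_contra hne
  have hcop : Nat.Coprime (ℓ : ℕ) (ℓ' : ℕ) := (Nat.coprime_primes ℓ.2.1 ℓ'.2.1).mpr (fun h' ↦ hne (Subtype.ext h'))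
  exact not_mem_asIdeal_of_coprime K hcop (plK ℓ) (hplK ℓ) (h ▸ hplK ℓ')

/-- **The (J) binder `hjump` of `supply_signed_of_jump_bound`, from the Poitou–Tate fact alone** — the ORDINARY-side
clauses of `hjump_of_localLagrangians` (part XVIII) discharged by `Method2.ordinaryLocalCondition` (parts XIX–XX:
`hordIso_∕hordCard_∕hordIncl_ordinaryLocalCondition`) and the TRANSVERSE-side clauses by `Method2.transverseLocalCondition`
(part XXI and §4). Frame: `K` imaginary quadratic with `d_K < −4` (`u_K = 1`, so
`#Gal(K[ℓ]/K[1]) = ℓ + 1`). [cite: WZhang2014, Lemma 8.2] [cite: McCallumLMS1991, Prop. 2.1] [cite: MilneADT2006, Ch. I,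
Thm. 4.10] -/
theorem hjump_of_poitouTate (hK : IsImaginaryQuadratic K) (hd : NumberField.discr K < -4)
    (hPT : poitouTate_selmerStructure_duality K) (ι : K →+* ℂ)
    (plK : {ℓ // Zhang2014.IsKolyvaginPrime (W.conductorNorm ℤ) W K 3 ℓ} → HeightOneSpectrum (𝓞 K))
    (hplK : ∀ ℓ, ((ℓ : ℕ) : 𝓞 K) ∈ (plK ℓ).asIdeal) :
    ∀ (n : Finset {q // IsUAdmissiblePrime W K q}), GoodLevel W K n → n.Nonempty →
      ∀ (ℓ : {ℓ // Zhang2014.IsKolyvaginPrime (W.conductorNorm ℤ) W K 3 ℓ}) (T : Finset _), ℓ ∉ T →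
      ∀ x₀ : V3 W K, ∃ x : V3 W K,
        ((∀ w : InfinitePlace K, x ∈ selmerLocalKer (W.baseChange K) w.Completion ((3 ^ 1 : ℕ) : ℤ)) ∧
          (∀ v : HeightOneSpectrum (𝓞 K), v ≠ plK ℓ → (∀ ℓ' ∈ T, plK ℓ' ≠ v) →
            ((∀ q ∈ n, ((q : ℕ) : 𝓞 K) ∉ v.asIdeal) →
              x ∈ selmerLocalKer (W.baseChange K) (v.adicCompletion K) ((3 ^ 1 : ℕ) : ℤ)) ∧
            (∀ q ∈ n, ((q : ℕ) : 𝓞 K) ∈ v.asIdeal →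
              x ∈ (W.baseChange K).ordinaryLocalKer (v.adicCompletion K) ((3 ^ 1 : ℕ) : ℤ))) ∧
          (∀ ℓ' ∈ T, x ∈ transverseLocalKer W K ι ℓ' (plK ℓ'))) ∧
        ∀ a : ℤ, x - a • x₀ ∉ (W.baseChange K).torsionLocalKer ((plK ℓ).adicCompletion K) ((3 ^ 1 : ℕ) : ℤ) := by
  have hinj := plK_injective W K plK hplK
  -- the two families of genuine local conditions
  let Lord : (v : HeightOneSpectrum (𝓞 K)) →
      AddSubgroup (galoisCohomology (((W.baseChange K).torsionGaloisModule ((3 ^ 1 : ℕ) : ℤ)).toLocal (Sum.inr v)) 1) :=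
    fun v ↦ ordinaryLocalCondition (W.baseChange K) (v.adicCompletion K) ((3 ^ 1 : ℕ) : ℤ)
  let Ltr : (v : HeightOneSpectrum (𝓞 K)) →
      AddSubgroup (galoisCohomology (((W.baseChange K).torsionGaloisModule ((3 ^ 1 : ℕ) : ℤ)).toLocal (Sum.inr v)) 1) :=
    fun v ↦ if h : ∃ ℓ', plK ℓ' = v then
      transverseLocalCondition (W.baseChange K) ι (Classical.choose h).1 (v.adicCompletion K) ((3 ^ 1 : ℕ) : ℤ) else ⊥
  have hLtr : ∀ ℓ', Ltr (plK ℓ') = transverseLocalCondition (W.baseChange K) ι ℓ'.1 ((plK ℓ').adicCompletion K)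
      ((3 ^ 1 : ℕ) : ℤ) := by
    intro ℓ'
    have h : ∃ ℓ'', plK ℓ'' = plK ℓ' := ⟨ℓ', rfl⟩
    have hc : Classical.choose h = ℓ' := hinj (Classical.choose_spec h)
    simp only [Ltr, dif_pos h]
    rw [hc]
  refine hjump_of_localLagrangians W K ι hK hPT plK hplK Lord Ltr
    (fun q hq v hqv e hμ hadd₁ hadd₂ halt _ hgal ↦ hordIso_ordinaryLocalCondition W K hK q hq v hqv e hμ hadd₁ hadd₂ halt hgal)
    (fun q hq v hqv ↦ hordCard_ordinaryLocalCondition W K hK q hq v hqv)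
    (fun q _ v _ x hx ↦ hordIncl_ordinaryLocalCondition W K v x hx)
    (fun ℓ' e hμ hadd₁ hadd₂ _ _ hgal a ha b hb ↦ ?_) (fun ℓ' ↦ ?_) (fun ℓ' x hx ↦ ?_)
  · rw [hLtr] at ha hb
    exact htrIso_transverseLocalCondition W K hK hd ι ℓ'.2 (plK ℓ') (hplK ℓ') e hμ hadd₁ hadd₂ hgal a ha b hb
  · rw [hLtr]
    exact htrCard_transverseLocalCondition W K hK hd ι ℓ'.2 (plK ℓ') (hplK ℓ')
  · rw [hLtr] at hx
    exact htrIncl_transverseLocalCondition W K hK ι ℓ'.2 (plK ℓ') (hplK ℓ') x hx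

end Summit.BirchSwinnertonDyer.Rank1Residual.X11b.Three.Koly.ZhangSupply

end
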